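import Literature.AlgebraicGeometry.Surfaces.K3CorrespondenceComposition
import Literature.AlgebraicGeometry.Motives.ComplexPointsOrientation
import HarnessLib

/-!
# Buskin's theorem (rational Hodge isometries of K3 surfaces are algebraic): the two remaining printed ingredients named, and the assembly

Family `hodge`, layer `Literature/AlgebraicGeometry/Surfaces`. Fact-decomposition record (librarian,
fact-decompose, 2026-08-16) for the named fact
`Literature.AlgebraicGeometry.Surfaces.Buskin2019_hodgeIsometry_algebraic` (N. Buskin, J. reine
angew. Math. 755 (2019), Thm. 1.1; reproof D. Huybrechts, Comment. Math. Helv. 94 (2019)), an XL fact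
that ran to the prover budget cap. Its proof files (`K3SurfaceProofs`, `K3CorrespondenceComposition`,
`K3PeriodSurjectivity*`, `K3Marking`, `LinearAlgebra/QuadraticForm/CartanDieudonne`,
`HodgeTheory/CorrespondenceComposition`, `HodgeTheory/GysinBaseChange`) PROVE the printed proof of
Thm. 1.1 (§6.2: signs of the generators of `H⁴`; Cartan–Dieudonné over `ℚ` with denominators cleared;
the chain of marked projective K3 surfaces through the surjectivity of the period map; composition
along the chain; Lemma 6.3 from Fulton's composition of correspondences and the proved Gysin base
change) MODULO four inputs — `Buskin2019_hodgeIsometry_algebraic_of_reflective_of_cup`: the two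
named facts `Huybrechts_K3_periodSurjective_projective`, `Huybrechts_K3_marking_exists` of the tree and
two explicit hypotheses `hrefl₀`, `hCUP`, which are named here:

* `Buskin2019_reflectiveHodgeIsometry_algebraic` — **Buskin's Prop. 6.2** (isometries of cyclic type
  between projective K3 surfaces are algebraic: Mukai's moduli of sheaves, twistor lines,
  hyperholomorphic transport, global Torelli) **for REFLECTIVE isometries** `η⁻¹ ∘ s_v ∘ η'` between
  marked projective K3 surfaces (`s_v` the reflection along a non-isotropic lattice vector `v`, of
  cyclic type by §3 Example 3.2), in the tree's vocabulary and for every orientation family (one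
  family suffices: `reflective_of_orientationFamily`, `K3SurfaceProofs`);
* `cupProduct_mem_algebraicClasses_tripleProduct_surfaces` — **cup products of algebraic classes are
  algebraic** (Voisin II Prop. 9.20 / Fulton §19.2: the cycle class map is a ring homomorphism) in the
  instance the composition of correspondences between surfaces needs: on a triple product
  `A ⊗ (B ⊗ C)` of smooth projective surfaces, `N² H⁴ ∪ N² H⁴ ⊆ N⁴ H⁸`. The general statement
  (`Nˡ H²ˡ ∪ Nᵏ H²ᵏ ⊆ N^{l+k} H^{2(l+k)}` for every smooth projective `X`) is the body of the route
  item `CupProductAlgebraic` of two Hodge routes and is reduced to the moving lemma in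
  `HodgeTheory/AlgebraicClassesCup` (`cupProduct_mem_algebraicClasses_of_moving`); a prover of this
  child may equally prove that general form and specialise.
  -- TODO(general form): `∀ n X, IsSmoothProjective n X → ∀ l k a b, a ∈ Nˡ → b ∈ Nᵏ → a ∪ b ∈ N^{l+k}`
  -- belongs in `HodgeTheory/` (Voisin II Prop. 9.20); this child is its `(2,2)` instance on
  -- triple products of surfaces.

The assembly `Buskin2019_hodgeIsometry_algebraic_holds_of` is
`Buskin2019_hodgeIsometry_algebraic_of_reflective_of_cup` at the orientation family given by
`Motives.ComplexPoints.isOrientableOver` (any one works).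

## References

* [Buskin2019] N. Buskin, *Every rational Hodge isometry between two K3 surfaces is algebraic*,
  J. reine angew. Math. 755 (2019) 127–150 (arXiv:1510.02852): Thm. 1.1, §3 Example 3.2, §6.2
  (proof of Thm. 1.1, Prop. 6.2, Lemma 6.3).
* [Huybrechts2019] D. Huybrechts, *Motives of isogenous K3 surfaces*, Comment. Math. Helv. 94 (2019),
  §1.1.
* [Huybrechts2016K3] D. Huybrechts, *Lectures on K3 Surfaces*, CUP 2016, Ch. 6 §1.1, Prop. 1.2,
  Prop. 2.3, Rem. 3.3; Ch. 1 Prop. 3.5.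
* [VoisinHodgeII2003] C. Voisin, *Hodge Theory and Complex Algebraic Geometry II*, CUP 2003, §9.2.4
  Prop. 9.20, Prop. 9.21 (i), Lemma 9.22.
* [Fulton1998] W. Fulton, *Intersection Theory*, 2nd ed., Springer 1998, §16.1, §19.2.
-/

noncomputable section

open CategoryTheory MonoidalCategory
open Literature.AlgebraicTopology.SingularHomology
open Literature.LinearAlgebra.QuadraticForm

namespace Literature.AlgebraicGeometry.Surfaces

section Leaves

/-- `MarkedK3[S, η, p, x]` (as in `K3SurfaceProofs`): the data of a MARKED K3 surface with period
`x` — `η : H²(S(ℂ); ℂ) ≅ Λ_ℂ` identifies the integral classes with `Λ = ℤ²²` and the cup product with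
the lattice form times the integral generator `p` of `H⁴(S(ℂ); ℤ)`, and `η⁻¹(x)` spans `H^{2,0}(S)`.
Local notation only. -/
local notation3 (prettyPrint := false) "MarkedK3[" S ", " η ", " p ", " x "]" =>
  (HodgeTheory.IsIntegralClass p ∧
    (∀ q : HodgeTheory.complexBetti S (2 * 2), HodgeTheory.IsIntegralClass q → ∃ n : ℤ, q = n • p) ∧
    (∀ c : HodgeTheory.complexBetti S (2 * 1),
        HodgeTheory.IsIntegralClass c ↔ ∃ v : K3Index → ℤ, η c = fun i => (v i : ℂ)) ∧
    (∀ a b : HodgeTheory.complexBetti S (2 * 1),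
        cupProduct (rfl : 2 * 1 + 2 * 1 = 2 * 2) a b = k3Form (η a) (η b) • p) ∧
    HodgeTheory.IsOfHodgeType 2 S (2 * 1) 2 0 (LinearEquiv.symm η x) ∧
    (∀ τ : HodgeTheory.complexBetti S (2 * 1),
        HodgeTheory.IsOfHodgeType 2 S (2 * 1) 2 0 τ → ∃ t : ℂ, τ = t • LinearEquiv.symm η x))

/-- `PeriodPt[x]` (as in `K3SurfaceProofs`): `x ∈ Λ_ℂ` is a PROJECTIVE period point — `(x.x) = 0`,
`(x̄.x) > 0`, and some lattice vector `u ∈ x^⊥` has `(u.u) > 0`. Local notation only. -/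
local notation3 (prettyPrint := false) "PeriodPt[" x "]" =>
  (k3Form x x = 0 ∧ 0 < (k3Form (star x) x).re ∧
    ∃ u : K3Index → ℤ, k3Form (fun i => (u i : ℂ)) x = 0 ∧ 0 < ∑ i, ∑ j, u i * k3Gram i j * u j)

/-- `Corr[μ, S, S', hS, hS' ; γ, y] = [γ]_* y = fst_* (snd^* y ∪ γ)` (as in `K3SurfaceProofs`):
LITERALLY the expression in the conclusion of `Buskin2019_hodgeIsometry_algebraic`. Local notation
only. -/
local notation3 (prettyPrint := false) "Corr[" μ ", " S ", " S' ", " hS ", " hS' " ; " γ ", " y "]" =>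
  HodgeTheory.complexGysin μ
    (Motives.IsSmoothProjective.tensor_holds (IsK3Surface.isSmoothProjective hS)
      (IsK3Surface.isSmoothProjective hS'))
    (IsK3Surface.isSmoothProjective hS) (SemiCartesianMonoidalCategory.fst S S')
    (rfl : 2 * 1 + 2 * 2 + 2 * 2 = 2 * 1 + 2 * (2 + 2))
    (cupProduct (rfl : 2 * 1 + 2 * 2 = 2 * 1 + 2 * 2)
      (HodgeTheory.complexBetti.map (SemiCartesianMonoidalCategory.snd S S') (2 * 1) y) γ)

/-! ### The two remaining ingredients, named -/

/-- **Buskin 2019, Prop. 6.2 (isometries of cyclic type are algebraic), for reflective isometries.**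
For marked projective K3 surfaces `(S, η, p, x)`, `(S', η', p', x')` (markings `η`, `η'` onto
`Λ_ℂ = (Λ_{K3}) ⊗ ℂ`, `Λ_{K3} = E₈(−1)^{⊕2} ⊕ U^{⊕3}`, with projective periods `x`, `x'`: Huybrechts,
*Lectures on K3 Surfaces*, Ch. 6 §3.2–3.3) and a non-isotropic lattice vector `v ∈ Λ` whose
reflection `s_v` carries the period line of `S'` into that of `S` (`s_v(x') ∈ ℂ x`), the rational
Hodge isometry `ψ = η⁻¹ ∘ s_v ∘ η' : H²(S'(ℂ); ℂ) → H²(S(ℂ); ℂ)` — of cyclic type (§3, Example 3.2: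
reflections along primitive vectors), and a HODGE isometry because a rational isometry of K3
surfaces carrying `H^{2,0}` onto `H^{2,0}` preserves the whole Hodge structure (Huybrechts Ch. 6
Prop. 1.2, Example 1.3 (i)) — is induced by an ALGEBRAIC class: `ψ = [γ]_* = fst_* (snd^*(–) ∪ γ)`
for some `γ ∈ algebraicClasses (S ⊗ S') 2`. This is the case of Prop. 6.2 (§6.2, "each `ψ_i` is
algebraic by Proposition (Cyclic-characteristic)": twistor paths in the moduli of marked K3
surfaces, Mukai's moduli spaces of sheaves and hyperholomorphic transport, global Torelli) that the
printed proof of Thm. 1.1 uses after Cartan–Dieudonné; stated for every orientation family `μ` of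
the Gysin formalism (one family suffices, `reflective_of_orientationFamily` of `K3SurfaceProofs`).
Verbatim the hypothesis `hrefl` of `Buskin2019_hodgeIsometry_algebraic_of_marking` (there with the
theorem `μ.HasPoincareDuality` as an extra premise) / `hrefl₀` of `…_of_reflective_of_cup` (one `μ₀`).
[cite: Buskin2019, §6.2 Prop. 6.2 and proof of Thm. 1.1; §3 Example 3.2]
[cite: Huybrechts2016K3, Ch. 6 Prop. 1.2, Example 1.3 (i), §3.2–3.3 and Rem. 3.3] -/
def Buskin2019_reflectiveHodgeIsometry_algebraic : Prop :=
  ∀ (μ : HodgeTheory.OrientationFamily)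
    (S S' : Motives.SchemeOver ℂ) (hS : IsK3Surface S) (hS' : IsK3Surface S')
    (η : HodgeTheory.complexBetti S (2 * 1) ≃ₗ[ℂ] (K3Index → ℂ))
    (p : HodgeTheory.complexBetti S (2 * 2)) (x : K3Index → ℂ)
    (η' : HodgeTheory.complexBetti S' (2 * 1) ≃ₗ[ℂ] (K3Index → ℂ))
    (p' : HodgeTheory.complexBetti S' (2 * 2)) (x' : K3Index → ℂ),
    MarkedK3[S, η, p, x] → PeriodPt[x] → MarkedK3[S', η', p', x'] → PeriodPt[x'] →
    ∀ v : K3Index → ℤ, ∑ i, ∑ j, v i * k3Gram i j * v j ≠ 0 →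
    (∃ t : ℂ, k3ReflectionC v x' = t • x) →
    ∃ γ ∈ HodgeTheory.algebraicClasses (MonoidalCategoryStruct.tensorObj S S') 2,
      ∀ y : HodgeTheory.complexBetti S' (2 * 1),
        η.symm (k3ReflectionC v (η' y)) = Corr[μ, S, S', hS, hS' ; γ, y]

/-- **Cup products of algebraic classes are algebraic — the instance on triple products of smooth
projective surfaces, codimensions `2 + 2`.** For `A`, `B`, `C` smooth projective surfaces over `ℂ`
and `a, b ∈ N² H⁴((A ⊗ (B ⊗ C))(ℂ); ℂ) = algebraicClasses _ 2` (the tree's carrier of algebraic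
classes: the coniveau span of classes supported on Zariski-closed subsets of codimension `≥ 2`, file
`HodgeTheory/AlgebraicClasses`), the cup product `a ∪ b` lies in `N⁴ H⁸ = algebraicClasses _ 4`.
Printed (for every smooth projective `X` and all codimensions): Voisin II, Prop. 9.20 — "for
`Z ∈ CHˡ(X)`, `Z' ∈ CHᵏ(X)`, `cl(Z · Z') = cl(Z) ∪ cl(Z')`", with Prop. 9.21 (i) and Lemma 9.22
(Chow's moving lemma) for the supports; Fulton, *Intersection Theory*, §19.2 (the cycle map is a
ring homomorphism; "for `X` quasi-projective and non-singular … may also be deduced from the moving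
lemma", §11.4). The tree proves the topological half and the reduction of the general statement to
moving supports (`HodgeTheory.cupProduct_mem_algebraicClasses_of_moving`, `AlgebraicClassesCup`); the
general statement — a theorem in print, Voisin II Prop. 9.20 — is also the body of the route item
`CupProductAlgebraic` of two Hodge routes, of which this
is the instance consumed by the composition of correspondences between surfaces
(`HodgeTheory.corrComp_surfaces_of_cup`, `GysinBaseChange`; here through `corrComp_K3_of_cup`).
Verbatim the hypothesis `hCUP` of `Buskin2019_hodgeIsometry_algebraic_of_reflective_of_cup`.
[cite: VoisinHodgeII2003, §9.2.4 Prop. 9.20, Prop. 9.21 (i) and Lemma 9.22]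
[cite: Fulton1998, §19.2 (cycle map is a ring homomorphism) and §11.4 (moving lemma)] -/
def cupProduct_mem_algebraicClasses_tripleProduct_surfaces : Prop :=
  ∀ (A B C : Motives.SchemeOver ℂ), Motives.IsSmoothProjective 2 A →
    Motives.IsSmoothProjective 2 B → Motives.IsSmoothProjective 2 C →
    ∀ a ∈ HodgeTheory.algebraicClasses (A ⊗ (B ⊗ C)) 2,
    ∀ b ∈ HodgeTheory.algebraicClasses (A ⊗ (B ⊗ C)) 2,
      cupProduct ((Nat.mul_add 2 2 2).symm : 2 * 2 + 2 * 2 = 2 * (2 + 2)) a b ∈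
        HodgeTheory.algebraicClasses (A ⊗ (B ⊗ C)) (2 + 2)

/-! ### The assembly -/

/-- **Buskin's Theorem 1.1 (`Buskin2019_hodgeIsometry_algebraic`) from its four named leaves**
(fact-decomposition glue, canonical name): Prop. 6.2 for reflective isometries and the
multiplicativity of algebraic classes (this file), the surjectivity of the period map in projective
form (`Huybrechts_K3_periodSurjective_projective`) and the existence of markings with projective
periods (`Huybrechts_K3_marking_exists`). The printed proof (§6.2: signs of `p, p'`, Cartan–Dieudonné,
the chain of marked projective K3 surfaces, composition by Lemma 6.3) is the PROVED theorem
`Buskin2019_hodgeIsometry_algebraic_of_reflective_of_cup` (`K3CorrespondenceComposition`), applied at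
the orientation family supplied by `Motives.ComplexPoints.isOrientableOver` (any family works).
[cite: Buskin2019, Thm. 1.1 and §6.2 (proof of Thm. 1.1, Prop. 6.2, Lemma 6.3)] [cite: Huybrechts2019, §1.1] -/
theorem Buskin2019_hodgeIsometry_algebraic_holds_of
    (hrefl : Buskin2019_reflectiveHodgeIsometry_algebraic)
    (hCUP : cupProduct_mem_algebraicClasses_tripleProduct_surfaces)
    (h : Huybrechts_K3_periodSurjective_projective) (hM : Huybrechts_K3_marking_exists) :
    Buskin2019_hodgeIsometry_algebraic :=
  let μ₀ : HodgeTheory.OrientationFamily := fun _ _ hY ↦ (Motives.ComplexPoints.isOrientableOver ℂ hY).some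
  Buskin2019_hodgeIsometry_algebraic_of_reflective_of_cup μ₀ h hM (hrefl μ₀) hCUP

end Leaves

end Literature.AlgebraicGeometry.Surfaces

end
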